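import Summits.HodgeConjecture.HodgeCM.PerL34.PrintedOpEndState_1

/-! PORT of `HodgeCM/PerL34/PrintedOpEndState.lean` (HodgeCMPerL run 82) — part 2: continuation of `Summits.HodgeConjecture.HodgeCM.PerL34.PrintedOpEndState_1` (split at a top-level declaration boundary by port_pkg.py; scope re-opened below; declarations unchanged). -/

-- port_pkg: scope re-opened for this part (file-level context, then the namespace/section stack open at the cut)
set_option autoImplicit false
noncomputable section
open MeasureTheory
namespace HodgeCM
namespace Universe
namespace AdelicTorusCore
open HodgeCM.PerL34 HodgeCM.PerL34.ArchC HodgeCM.PerL34.Fock HodgeCM.PerL34.Fock.PrintDict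
open HodgeCM.Prior.Perl34File HodgeCM.Prior.Perl34File.Perl34
open NumberField NumberField.SeesawArchTorus
variable {U : Universe} {hP : PrintFact_unitaryCompact} (C : U.AdelicTorusCore hP)
  (R12 : ∀ {L : CMField} {ι₁ : L →+* ℂ} (V : HermSpace3 L ι₁) (c : SeesawCtx L), C.Rest12 V c)
  (R34 : ∀ {L : CMField} {ι₁ : L →+* ℂ} (V : HermSpace3 L ι₁) (c : SeesawCtx L), C.Rest34 V c)
  (hA : (C.rtc R12 R34).Analytic)
section Cont
variable {L : CMField} {ι₁ : L →+* ℂ} (V : HermSpace3 L ι₁) (c : SeesawCtx L)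

/-- **`Φ ↦ 𝒯_Φ` is continuous IN OPERATOR NORM on the end state (KERNEL)** — §0 `continuous_opTC_θ` with
`WeilThetaModel.θ_cont`; `𝒯_Φ = opTC (θ_Φ) ν` by `rfl` (node #2 `core_TΦc_eq`). -/
theorem continuous_TΦc :
    Continuous fun Φ : (ThetaModel.ofRegCarrier (C.rtc R12 R34) hA).SK V c =>
      ((ThetaModel.ofRegCarrier (C.rtc R12 R34) hA).core V c).TΦc Φ :=
  KernelModel.continuous_opTC_θ (V.latticeModel hP).toQuotientModel (c.D.latticeModelW hP).toQuotientModel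
    (C.wm V c).θ (C.wm V c).θ_cont

end Cont

section OpenOcc

/-- **The (12) OPERATOR-SIDE printed core of a context on the END STATE**: a kind map, non-zero scalings, and an
operator-side analytic side (eighteen fields, §2) over `T∘.core V c` at the canonical points `C.pointedCore` (node #2) and
the canonical chart `chart12` (node #1) with the pinned vacuum characters of the typed weight of `R12 V c`.  No field
mentions a structure on `𝒮^κ`, the torus datum, N21 or `cont`. -/
structure OpPrintedCore12 {L : CMField} {ι₁ : L →+* ℂ} (V : HermSpace3 L ι₁) (c : SeesawCtx L) where
  /-- decidable equality of the infinite places (any instance; used only to form the printed places) -/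
  [decEq : DecidableEq (InfinitePlace (L : Type))]
  /-- the kind `Σ₁₂ / D₁₂ / ι₁` of each infinite place -/
  kind : InfinitePlace (L : Type) → PlaceKind
  /-- the printed scalings `λ_b ≠ 0` -/
  lam : InfinitePlace (L : Type) → ℂ
  hlam : ∀ w, lam w ≠ 0
  /-- the operator-side analytic side at the canonical points and the canonical (12) chart -/
  side : OpAnalyticSide ((ThetaModel.ofRegCarrier (C.rtc R12 R34) hA).core V c) (C.pointedCore R12 R34 hA V c)
    (InfinitePlace (L : Type)) kind lam hlam (pinnedVacs kind (R12 V c).m₁ (R12 V c).m₂)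
    (C.chart12 R12 V c kind lam hlam)

/-- **The (34) OPERATOR-SIDE printed core of a context on the END STATE** (`chart34`, typed weight of `R34 V c`). -/
structure OpPrintedCore34 {L : CMField} {ι₁ : L →+* ℂ} (V : HermSpace3 L ι₁) (c : SeesawCtx L) where
  [decEq : DecidableEq (InfinitePlace (L : Type))]
  kind : InfinitePlace (L : Type) → PlaceKind
  lam : InfinitePlace (L : Type) → ℂ
  hlam : ∀ w, lam w ≠ 0
  side : OpAnalyticSide ((ThetaModel.ofRegCarrier (C.rtc R12 R34) hA).core V c) (C.pointedCore R12 R34 hA V c)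
    (InfinitePlace (L : Type)) kind lam hlam (pinnedVacs kind (R34 V c).m₁ (R34 V c).m₂)
    (C.chart34 R34 V c kind lam hlam)

namespace OpPrintedCore12

variable {C R12 R34 hA} {L : CMField} {ι₁ : L →+* ℂ} {V : HermSpace3 L ι₁} {c : SeesawCtx L}

/-- pv08-g3's D-free chart on the end state, pair (12): N21 := node #2's theorem `invariance`. -/
def toCore (A : OpPrintedCore12 C R12 R34 hA V c) :
    ArchCCore ((ThetaModel.ofRegCarrier (C.rtc R12 R34) hA).core V c) (C.pointedCore R12 R34 hA V c) :=
  letI := A.decEq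
  A.side.toCore (C.invariance R12 R34 hA V c)

/-- **Lemma 4.1(c), pair (12), on the END STATE from the operator-side printed core alone**: N21 := node #2 `invariance`,
the occurrence := node #1 `t12_wOccurs_of_printedEigenvector`; conclusion literally `(T∘.t12 V c).wOccurs i`. -/
theorem H_occ (A : OpPrintedCore12 C R12 R34 hA V c) :
    ∀ (Φ : (ThetaModel.ofRegCarrier (C.rtc R12 R34) hA).SK V c)
      (i : (ThetaModel.ofRegCarrier (C.rtc R12 R34) hA).SigIdx V c),
      (∃ v ∈ ((ThetaModel.ofRegCarrier (C.rtc R12 R34) hA).core V c).hatσ i,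
        ((ThetaModel.ofRegCarrier (C.rtc R12 R34) hA).core V c).TΦ Φ v ≠ 0) →
      ((ThetaModel.ofRegCarrier (C.rtc R12 R34) hA).t12 V c).wOccurs i :=
  letI := A.decEq
  A.side.occ_of_wOccurs (C.invariance R12 R34 hA V c)
    (C.t12_wOccurs_of_printedEigenvector R12 R34 V c A.kind A.lam A.hlam hA)

/-- **Node #1's printed core gives this one** (`ModelAnalyticSide.toOp` with the end-state operator-norm continuity
`continuous_TΦc`): the new end-state input is implied by the old. -/
def ofPrinted (B : PrintedCore12 C R12 R34 hA V c) : OpPrintedCore12 C R12 R34 hA V c :=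
  letI := B.decEq
  { decEq := B.decEq
    kind := B.kind
    lam := B.lam
    hlam := B.hlam
    side := B.side.toOp (C.continuous_TΦc R12 R34 hA V c) }

end OpPrintedCore12

namespace OpPrintedCore34

variable {C R12 R34 hA} {L : CMField} {ι₁ : L →+* ℂ} {V : HermSpace3 L ι₁} {c : SeesawCtx L}

/-- pv08-g3's D-free chart on the end state, pair (34). -/
def toCore (A : OpPrintedCore34 C R12 R34 hA V c) :
    ArchCCore ((ThetaModel.ofRegCarrier (C.rtc R12 R34) hA).core V c) (C.pointedCore R12 R34 hA V c) :=
  letI := A.decEq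
  A.side.toCore (C.invariance R12 R34 hA V c)

/-- **Lemma 4.1(c), pair (34), on the END STATE from the operator-side printed core alone.** -/
theorem H_occ (A : OpPrintedCore34 C R12 R34 hA V c) :
    ∀ (Φ : (ThetaModel.ofRegCarrier (C.rtc R12 R34) hA).SK V c)
      (i : (ThetaModel.ofRegCarrier (C.rtc R12 R34) hA).SigIdx V c),
      (∃ v ∈ ((ThetaModel.ofRegCarrier (C.rtc R12 R34) hA).core V c).hatσ i,
        ((ThetaModel.ofRegCarrier (C.rtc R12 R34) hA).core V c).TΦ Φ v ≠ 0) →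
      ((ThetaModel.ofRegCarrier (C.rtc R12 R34) hA).t34 V c).wOccurs i :=
  letI := A.decEq
  A.side.occ_of_wOccurs (C.invariance R12 R34 hA V c)
    (C.t34_wOccurs_of_printedEigenvector R12 R34 V c A.kind A.lam A.hlam hA)

/-- Node #1's (34) printed core gives this one. -/
def ofPrinted (B : PrintedCore34 C R12 R34 hA V c) : OpPrintedCore34 C R12 R34 hA V c :=
  letI := B.decEq
  { decEq := B.decEq
    kind := B.kind
    lam := B.lam
    hlam := B.hlam
    side := B.side.toOp (C.continuous_TΦc R12 R34 hA V c) }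

end OpPrintedCore34

/-- **`Open_occ` (N29 = PerL Lemma 4.1(c) / Thm 3.7 (†), BOTH torus sides) of the END-STATE theta model from
OPERATOR-SIDE printed analytic data**: per good context one `OpPrintedCore12` and one `OpPrintedCore34`.  No hypothesis
mentions a structure on `𝒮^κ`, the torus side, the points, N21 or a continuity of `Φ ↦ 𝒯_Φ`. -/
theorem Open_occ_of_opPrintedCores
    (A12 : ∀ {L : CMField} {ι₁ : L →+* ℂ} (V : HermSpace3 L ι₁) (c : SeesawCtx L),
      (ThetaModel.ofRegCarrier (C.rtc R12 R34) hA).GoodCtx ι₁ c → Nonempty (C.OpPrintedCore12 R12 R34 hA V c))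
    (A34 : ∀ {L : CMField} {ι₁ : L →+* ℂ} (V : HermSpace3 L ι₁) (c : SeesawCtx L),
      (ThetaModel.ofRegCarrier (C.rtc R12 R34) hA).GoodCtx ι₁ c → Nonempty (C.OpPrintedCore34 R12 R34 hA V c)) :
    (ThetaModel.ofRegCarrier (C.rtc R12 R34) hA).Open_occ :=
  fun V c hc => ⟨fun Φ i h => (A12 V c hc).elim fun A => A.H_occ Φ i h,
    fun Φ i h => (A34 V c hc).elim fun A => A.H_occ Φ i h⟩

/-- **N29 BY THE CARVER'S NAME** (`Arch.N29_occ`) on the end state, from the operator-side printed cores. -/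
theorem N29_occ_of_opPrintedCores
    (A12 : ∀ {L : CMField} {ι₁ : L →+* ℂ} (V : HermSpace3 L ι₁) (c : SeesawCtx L),
      (ThetaModel.ofRegCarrier (C.rtc R12 R34) hA).GoodCtx ι₁ c → Nonempty (C.OpPrintedCore12 R12 R34 hA V c))
    (A34 : ∀ {L : CMField} {ι₁ : L →+* ℂ} (V : HermSpace3 L ι₁) (c : SeesawCtx L),
      (ThetaModel.ofRegCarrier (C.rtc R12 R34) hA).GoodCtx ι₁ c → Nonempty (C.OpPrintedCore34 R12 R34 hA V c)) :
    N29_occ (ThetaModel.ofRegCarrier (C.rtc R12 R34) hA) :=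
  C.Open_occ_of_opPrintedCores R12 R34 hA A12 A34

/-- Node #1's `Open_occ_of_printedCores` FACTORS through the operator side (`ofPrinted`). -/
theorem Open_occ_of_printedCores'
    (A12 : ∀ {L : CMField} {ι₁ : L →+* ℂ} (V : HermSpace3 L ι₁) (c : SeesawCtx L),
      (ThetaModel.ofRegCarrier (C.rtc R12 R34) hA).GoodCtx ι₁ c → Nonempty (C.PrintedCore12 R12 R34 hA V c))
    (A34 : ∀ {L : CMField} {ι₁ : L →+* ℂ} (V : HermSpace3 L ι₁) (c : SeesawCtx L),
      (ThetaModel.ofRegCarrier (C.rtc R12 R34) hA).GoodCtx ι₁ c → Nonempty (C.PrintedCore34 R12 R34 hA V c)) :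
    (ThetaModel.ofRegCarrier (C.rtc R12 R34) hA).Open_occ :=
  C.Open_occ_of_opPrintedCores R12 R34 hA (fun V c hc => (A12 V c hc).map OpPrintedCore12.ofPrinted)
    (fun V c hc => (A34 V c hc).map OpPrintedCore34.ofPrinted)

end OpenOcc

end AdelicTorusCore

/-! ## §4  The same for the sign-recipe end state `C₀.thetaModel h d12 d34` (prl1-g5) -/

namespace AdelicThetaCore

open HodgeCM.PerL34

variable {U : Universe} {hP : PrintFact_unitaryCompact} (C₀ : U.AdelicThetaCore hP) (h : Bool)
  (d12 d34 : ∀ {L : CMField}, SeesawCtx L → SideData L)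

/-- **`Open_occ` of prl1-g5's END-STATE model `C₀.thetaModel h d12 d34`** from the operator-side printed cores of its contexts
— `Open_occ_of_opPrintedCores` at `C := C₀.toCore h`, `R12 := side12 d12`, `R34 := side34 d34`,
`hA := (analyticKM …).toAnalytic`, by `rfl`. -/
theorem Open_occ_thetaModel_of_opPrintedCores
    (A12 : ∀ {L : CMField} {ι₁ : L →+* ℂ} (V : HermSpace3 L ι₁) (c : SeesawCtx L),
      (C₀.thetaModel h d12 d34).GoodCtx ι₁ c →
        Nonempty ((C₀.toCore h).OpPrintedCore12 ((C₀.toCore h).side12 d12) ((C₀.toCore h).side34 d34)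
          ((C₀.toCore h).analyticKM ((C₀.toCore h).side12 d12) ((C₀.toCore h).side34 d34)).toAnalytic V c))
    (A34 : ∀ {L : CMField} {ι₁ : L →+* ℂ} (V : HermSpace3 L ι₁) (c : SeesawCtx L),
      (C₀.thetaModel h d12 d34).GoodCtx ι₁ c →
        Nonempty ((C₀.toCore h).OpPrintedCore34 ((C₀.toCore h).side12 d12) ((C₀.toCore h).side34 d34)
          ((C₀.toCore h).analyticKM ((C₀.toCore h).side12 d12) ((C₀.toCore h).side34 d34)).toAnalytic V c)) :
    (C₀.thetaModel h d12 d34).Open_occ :=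
  (C₀.toCore h).Open_occ_of_opPrintedCores _ _ _ A12 A34

/-- … and by the carver's name `N29_occ`. -/
theorem N29_occ_thetaModel_of_opPrintedCores
    (A12 : ∀ {L : CMField} {ι₁ : L →+* ℂ} (V : HermSpace3 L ι₁) (c : SeesawCtx L),
      (C₀.thetaModel h d12 d34).GoodCtx ι₁ c →
        Nonempty ((C₀.toCore h).OpPrintedCore12 ((C₀.toCore h).side12 d12) ((C₀.toCore h).side34 d34)
          ((C₀.toCore h).analyticKM ((C₀.toCore h).side12 d12) ((C₀.toCore h).side34 d34)).toAnalytic V c))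
    (A34 : ∀ {L : CMField} {ι₁ : L →+* ℂ} (V : HermSpace3 L ι₁) (c : SeesawCtx L),
      (C₀.thetaModel h d12 d34).GoodCtx ι₁ c →
        Nonempty ((C₀.toCore h).OpPrintedCore34 ((C₀.toCore h).side12 d12) ((C₀.toCore h).side34 d34)
          ((C₀.toCore h).analyticKM ((C₀.toCore h).side12 d12) ((C₀.toCore h).side34 d34)).toAnalytic V c)) :
    N29_occ (C₀.thetaModel h d12 d34) :=
  C₀.Open_occ_thetaModel_of_opPrintedCores h d12 d34 A12 A34

end AdelicThetaCore

end Universe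

/-! ## §5  The binder-minimal END STATES with `occ` from operator-side printed cores -/

namespace Assembly

open HodgeCM.PerL34
open HodgeCM.Prior.Perl34File HodgeCM.Prior.Perl34File.Perl34
open HodgeCM.Universe (AdelicThetaCore AdelicThetaCore₀ AdelicTorusCore SideData ThetaModel)

variable (U : Universe)

/-- **Both realisation inputs of part (a), binder-minimal END STATE, `occ` from operator-side printed cores**: prl1-g5's
`realisationExists_ofSignRecipe₀` with the input `occ` (N29) REPLACED by the operator-side printed analytic cores of the good
contexts (`OpPrintedCore12` / `OpPrintedCore34`); the other seven non-design inputs by name. -/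
theorem realisationExists_ofSignRecipe₀_opPrintedCores (M : U.ModelAxioms) (h : Bool) (C : U.AdelicThetaCore₀)
    (d12 d34 : ∀ {L : CMField}, SeesawCtx L → SideData L)
    (embCover : (C.thetaModel h d12 d34).Fact_embCover) (innerEmb : (C.thetaModel h d12 d34).Fact_innerEmb)
    (thetaSub : (C.thetaModel h d12 d34).Open_thetaSub) (thetaWedge : (C.thetaModel h d12 d34).Open_thetaWedge)
    (thetaGen12 : (C.thetaModel h d12 d34).Open_thetaGen12)
    (thetaReal34 : (C.thetaModel h d12 d34).Open_thetaReal34) (chars : (C.thetaModel h d12 d34).Open_chars)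
    (A12 : ∀ {L : CMField} {ι₁ : L →+* ℂ} (V : HermSpace3 L ι₁) (c : SeesawCtx L),
      (C.thetaModel h d12 d34).GoodCtx ι₁ c →
        Nonempty ((C.toCore h).OpPrintedCore12 ((C.toCore h).side12 d12) ((C.toCore h).side34 d34)
          ((C.toCore h).analyticKM ((C.toCore h).side12 d12) ((C.toCore h).side34 d34)).toAnalytic V c))
    (A34 : ∀ {L : CMField} {ι₁ : L →+* ℂ} (V : HermSpace3 L ι₁) (c : SeesawCtx L),
      (C.thetaModel h d12 d34).GoodCtx ι₁ c →
        Nonempty ((C.toCore h).OpPrintedCore34 ((C.toCore h).side12 d12) ((C.toCore h).side34 d34)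
          ((C.toCore h).analyticKM ((C.toCore h).side12 d12) ((C.toCore h).side34 d34)).toAnalytic V c))
    (hHR : U.Fact_hodgeRiemann20) : U.RealisationExistsPerL ∧ U.RealisationExistsFace :=
  realisationExists_ofSignRecipe₀ U M h C d12 d34
    ⟨embCover, innerEmb, thetaSub, thetaWedge, thetaGen12, thetaReal34, chars,
      C.Open_occ_thetaModel_of_opPrintedCores h d12 d34 A12 A34⟩ hHR

/-- **PerL, binder-minimal END STATE, `occ` from operator-side printed cores.**  Binders: `M`; `h`; the core DATA `C`; the
torus-side DATA `d12`, `d34`; seven named theta inputs (2 PRINT + 5 OPEN); per good context the operator-side printed cores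
`A12`, `A34`; Hodge–Riemann. -/
theorem perL_ofSignRecipe₀_opPrintedCores (M : U.ModelAxioms) (h : Bool) (C : U.AdelicThetaCore₀)
    (d12 d34 : ∀ {L : CMField}, SeesawCtx L → SideData L)
    (embCover : (C.thetaModel h d12 d34).Fact_embCover) (innerEmb : (C.thetaModel h d12 d34).Fact_innerEmb)
    (thetaSub : (C.thetaModel h d12 d34).Open_thetaSub) (thetaWedge : (C.thetaModel h d12 d34).Open_thetaWedge)
    (thetaGen12 : (C.thetaModel h d12 d34).Open_thetaGen12)
    (thetaReal34 : (C.thetaModel h d12 d34).Open_thetaReal34) (chars : (C.thetaModel h d12 d34).Open_chars)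
    (A12 : ∀ {L : CMField} {ι₁ : L →+* ℂ} (V : HermSpace3 L ι₁) (c : SeesawCtx L),
      (C.thetaModel h d12 d34).GoodCtx ι₁ c →
        Nonempty ((C.toCore h).OpPrintedCore12 ((C.toCore h).side12 d12) ((C.toCore h).side34 d34)
          ((C.toCore h).analyticKM ((C.toCore h).side12 d12) ((C.toCore h).side34 d34)).toAnalytic V c))
    (A34 : ∀ {L : CMField} {ι₁ : L →+* ℂ} (V : HermSpace3 L ι₁) (c : SeesawCtx L),
      (C.thetaModel h d12 d34).GoodCtx ι₁ c →
        Nonempty ((C.toCore h).OpPrintedCore34 ((C.toCore h).side12 d12) ((C.toCore h).side34 d34)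
          ((C.toCore h).analyticKM ((C.toCore h).side12 d12) ((C.toCore h).side34 d34)).toAnalytic V c))
    (hHR : U.Fact_hodgeRiemann20) : U.PerL :=
  perL_ofSignRecipe₀ U M h C d12 d34
    ⟨embCover, innerEmb, thetaSub, thetaWedge, thetaGen12, thetaReal34, chars,
      C.Open_occ_thetaModel_of_opPrintedCores h d12 d34 A12 A34⟩ hHR

/-- **COR-CM, binder-minimal END STATE, `occ` from operator-side printed cores.** -/
theorem COR_CM_endState_ofSignRecipe₀_opPrintedCores (M : U.ModelAxioms) (h29 : U.Fact_weightSpan)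
    (h30 : U.Fact_weightHodge) (hE : U.Qw8ExtProd) (hD : U.Qw8DualPushPull) (hMi : U.Qw8Milne) (h : Bool)
    (C : U.AdelicThetaCore₀) (d12 d34 : ∀ {L : CMField}, SeesawCtx L → SideData L)
    (embCover : (C.thetaModel h d12 d34).Fact_embCover) (innerEmb : (C.thetaModel h d12 d34).Fact_innerEmb)
    (thetaSub : (C.thetaModel h d12 d34).Open_thetaSub) (thetaWedge : (C.thetaModel h d12 d34).Open_thetaWedge)
    (thetaGen12 : (C.thetaModel h d12 d34).Open_thetaGen12)
    (thetaReal34 : (C.thetaModel h d12 d34).Open_thetaReal34) (chars : (C.thetaModel h d12 d34).Open_chars)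
    (A12 : ∀ {L : CMField} {ι₁ : L →+* ℂ} (V : HermSpace3 L ι₁) (c : SeesawCtx L),
      (C.thetaModel h d12 d34).GoodCtx ι₁ c →
        Nonempty ((C.toCore h).OpPrintedCore12 ((C.toCore h).side12 d12) ((C.toCore h).side34 d34)
          ((C.toCore h).analyticKM ((C.toCore h).side12 d12) ((C.toCore h).side34 d34)).toAnalytic V c))
    (A34 : ∀ {L : CMField} {ι₁ : L →+* ℂ} (V : HermSpace3 L ι₁) (c : SeesawCtx L),
      (C.thetaModel h d12 d34).GoodCtx ι₁ c →
        Nonempty ((C.toCore h).OpPrintedCore34 ((C.toCore h).side12 d12) ((C.toCore h).side34 d34)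
          ((C.toCore h).analyticKM ((C.toCore h).side12 d12) ((C.toCore h).side34 d34)).toAnalytic V c))
    (hHR : U.Fact_hodgeRiemann20) : U.HC_CM :=
  COR_CM_endState_ofSignRecipe₀ U M h29 h30 hE hD hMi h C d12 d34
    ⟨embCover, innerEmb, thetaSub, thetaWedge, thetaGen12, thetaReal34, chars,
      C.Open_occ_thetaModel_of_opPrintedCores h d12 d34 A12 A34⟩ hHR

end Assembly

end HodgeCM

end
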